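import Summits.QuantumFields.YangMills.Theorems.PoincareLipschitzPlanarStreamFunctionLimitLetters
import HarnessLib

/-!
# Crux `BlockLipschitzL` (stmt-QuantumFields-23533) ∕ `HistoryTailL` (stmt-QuantumFields-19936), LINE 25 «CompactnessTransfer»,
# the (TM)∕(GAP) discharge ROADS (H)∕(W), brick (H) — file H6 «PLANAR STREAM FUNCTION: THE `L²` CAUCHY LETTERS»

Cell `ym3-torus` (YM ladder rung R3 = continuum SU(2) Yang–Mills on T³ — a RUNG, NOT Clay: not d = 4, not infinite volume,
not a mass gap); WIDTH helper seat `ym3-torus-px5` g9 (★w3 g16's RULING (α), row (i′): the stream function must be exported with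
`LocallyIntegrable ‖B‖²`); `--supports stmt-QuantumFields-23533`; THEOREMS ONLY (0 `def`, 0 `sorry`, default heartbeats); imports
H3 ✓`…PlanarStreamFunctionLimitLetters` (hence H1 ✓`…Letters`, H2 ✓`…Cauchy`).

WHAT THIS FILE DOES (`E² = EuclideanSpace ℝ (Fin 2)`) — the `L²` versions of the two Cauchy letters of H2∕H3:
* ★★ `eLpNorm_two_ball_le` — for `C¹` `G` with `∫_{B₁} G = 0` and `R ≥ 1`,
  `‖G‖_{L²(B_R)} ≤ (1 + |B_R|^{1∕2}·|B₁|^{1∕2}·|B₁|⁻¹)·4R·‖DG‖_{L²(E²)}` (Poincaré–Wirtinger is natively `L²`; the mean on `B_R` is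
  controlled by the normalisation on `B₁` and Cauchy–Schwarz on `B₁`);
* ★ `eLpNorm_two_sub_normalised_potentials_le` — the `L²(B_R)` Cauchy estimate for two normalised potentials of the rotated
  mollified fields (H3's `eLpNorm_sub_normalised_potentials_le` at exponent `2`).
File H7 runs the limit argument at `p = 2` and exports `exists_streamFunction_sq` with the extra row `LocallyIntegrable ‖B‖²`.
HONEST SCOPE.  Measure-theoretic letters; nothing of (GAP)∕(TM), (F)∕(F′), S1″, K1, `MeanDeviationL`, `BlockLipschitzL`, `HistoryTailL`
is proved here.  YM₃ on T³ is rung R3, not Clay; YM gap NOT proved; no summit statement is proved here.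

References: L. C. Evans, Partial Differential Equations (2010), §5.8.1 Thm. 1 [Evans2010].
-/

set_option autoImplicit false

noncomputable section

open scoped BigOperators Topology ENNReal NNReal Convolution InnerProductSpace
open MeasureTheory Set Filter Function TopologicalSpace Metric ContinuousLinearMap

namespace Summit.QuantumFields.YangMills.Theorems.PoincareLipschitzPlanarStreamFunctionL2Letters

open Literature.Analysis.FunctionSpaces (IsTestFunctionOn HasWeakFDerivOn lintegral_enorm_sub_setAverage_sq_le)
open Summit.QuantumFields.YangMills.Theorems.PoincareLipschitzPlanarStreamFunctionLetters
open Summit.QuantumFields.YangMills.Theorems.PoincareLipschitzPlanarStreamFunctionCauchy (eLpNorm_one_le_sqrt_measure_mul_eLpNorm_two)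
open Summit.QuantumFields.YangMills.Theorems.PoincareLipschitzPlanarStreamFunctionLimitLetters

/-! ## §1 The Poincaré–Wirtinger `L²` estimate on balls for normalised `C¹` functions -/

/-- ★★ **THE `L²` ESTIMATE ON BALLS FOR NORMALISED `C¹` FUNCTIONS.**  Let `G : E² → ℝ` be `C¹` with `∫_{B₁(0)} G = 0` and `R ≥ 1`.
Then `‖G‖_{L²(B_R)} ≤ (1 + |B_R|^{1∕2}·|B₁|^{1∕2}·|B₁|⁻¹)·4R·‖DG‖_{L²(E²)}`.  [cite: Evans2010, §5.8.1 Thm. 1] -/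
theorem eLpNorm_two_ball_le {G : EuclideanSpace ℝ (Fin 2) → ℝ} (hG : ContDiff ℝ 1 G)
    (h0 : ∫ y in ball (0 : EuclideanSpace ℝ (Fin 2)) 1, G y = 0) {R : ℝ} (hR : 1 ≤ R) :
    eLpNorm G 2 (volume.restrict (ball (0 : EuclideanSpace ℝ (Fin 2)) R)) ≤
      (1 + volume (ball (0 : EuclideanSpace ℝ (Fin 2)) R) ^ (1 / 2 : ℝ) *
          volume (ball (0 : EuclideanSpace ℝ (Fin 2)) 1) ^ (1 / 2 : ℝ) * (volume (ball (0 : EuclideanSpace ℝ (Fin 2)) 1))⁻¹) *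
        ENNReal.ofReal (4 * R) * eLpNorm (fderiv ℝ G) 2 volume := by
  set BR : Set (EuclideanSpace ℝ (Fin 2)) := ball 0 R with hBR
  set B1 : Set (EuclideanSpace ℝ (Fin 2)) := ball 0 1 with hB1
  set μR : Measure (EuclideanSpace ℝ (Fin 2)) := volume.restrict BR with hμR
  have hR0 : 0 < R := lt_of_lt_of_le one_pos hR
  have hB1R : B1 ⊆ BR := ball_subset_ball hR
  have hvR0 : volume BR ≠ 0 := (measure_ball_pos volume (0 : EuclideanSpace ℝ (Fin 2)) hR0).ne'
  have hvRt : volume BR ≠ ⊤ := measure_ball_lt_top.ne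
  have hv10 : volume B1 ≠ 0 := (measure_ball_pos volume (0 : EuclideanSpace ℝ (Fin 2)) one_pos).ne'
  have hv1t : volume B1 ≠ ⊤ := measure_ball_lt_top.ne
  have hGc : Continuous G := hG.continuous
  have hGi : IntegrableOn G BR volume :=
    (hGc.continuousOn.integrableOn_compact (isCompact_closedBall (0 : EuclideanSpace ℝ (Fin 2)) R)).mono_set
      ball_subset_closedBall
  set c : ℝ := ⨍ y in BR, G y with hc
  -- Step 1: Poincaré–Wirtinger in `L²(B_R)`
  have hPW : eLpNorm (fun y => G y - c) 2 μR ≤ ENNReal.ofReal (4 * R) * eLpNorm (fderiv ℝ G) 2 volume := by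
    have hD : ∀ y ∈ BR, ∀ z ∈ BR, ‖y - z‖ ≤ 2 * R := by
      intro y hy z hz
      rw [hBR, mem_ball_zero_iff] at hy hz
      calc ‖y - z‖ ≤ ‖y‖ + ‖z‖ := norm_sub_le y z
        _ ≤ 2 * R := by linarith
    have h := lintegral_enorm_sub_setAverage_sq_le (μ := volume) hG (convex_ball (0 : EuclideanSpace ℝ (Fin 2)) R)
      measurableSet_ball hvR0 hvRt hGi hD
    rw [finrank_euclideanSpace_fin] at h
    have hconst : ENNReal.ofReal ((2:ℝ) ^ 2 * (2 * R) ^ 2) = ENNReal.ofReal (4 * R) ^ 2 := by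
      rw [← ENNReal.ofReal_pow (by positivity)]
      congr 1; ring
    rw [hconst] at h
    have h2a : eLpNorm (fun y => G y - c) 2 μR = (∫⁻ y, ‖G y - c‖ₑ ^ 2 ∂μR) ^ (1 / 2 : ℝ) := by
      rw [eLpNorm_eq_lintegral_rpow_enorm_toReal two_ne_zero ENNReal.ofNat_ne_top, ENNReal.toReal_ofNat]
      congr 1
      refine lintegral_congr fun x => ?_
      rw [ENNReal.rpow_two]
    have h2b : eLpNorm (fderiv ℝ G) 2 volume = (∫⁻ y, ‖fderiv ℝ G y‖ₑ ^ 2) ^ (1 / 2 : ℝ) := by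
      rw [eLpNorm_eq_lintegral_rpow_enorm_toReal two_ne_zero ENNReal.ofNat_ne_top, ENNReal.toReal_ofNat]
      congr 1
      refine lintegral_congr fun x => ?_
      rw [ENNReal.rpow_two]
    have hsqrt : ∀ a : ℝ≥0∞, (a ^ 2) ^ (1 / 2 : ℝ) = a := by
      intro a
      have h12 : (1 / 2 : ℝ) = ((2 : ℕ) : ℝ)⁻¹ := by norm_num
      rw [h12]
      exact ENNReal.pow_rpow_inv_natCast two_ne_zero a
    rw [h2a, h2b, hμR]
    calc (∫⁻ y in BR, ‖G y - c‖ₑ ^ 2) ^ (1 / 2 : ℝ)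
        ≤ (ENNReal.ofReal (4 * R) ^ 2 * ∫⁻ y in BR, ‖fderiv ℝ G y‖ₑ ^ 2) ^ (1 / 2 : ℝ) :=
          ENNReal.rpow_le_rpow h (by norm_num)
      _ ≤ (ENNReal.ofReal (4 * R) ^ 2 * ∫⁻ y, ‖fderiv ℝ G y‖ₑ ^ 2) ^ (1 / 2 : ℝ) := by
          gcongr
          exact Measure.restrict_le_self
      _ = ENNReal.ofReal (4 * R) * (∫⁻ y, ‖fderiv ℝ G y‖ₑ ^ 2) ^ (1 / 2 : ℝ) := by
          rw [ENNReal.mul_rpow_of_nonneg _ _ (by norm_num), hsqrt]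
  -- Step 2: the mean `c` from the normalisation on `B₁`: `‖c‖ₑ·|B₁| ≤ ‖G − c‖_{L¹(B₁)} ≤ |B₁|^{1/2}‖G − c‖_{L²(B_R)}`
  have hGcm : AEStronglyMeasurable (fun y => G y - c) volume := (hGc.sub continuous_const).aestronglyMeasurable
  set X : ℝ≥0∞ := eLpNorm (fun y => G y - c) 2 μR with hX
  have hcB1 : ‖c‖ₑ * volume B1 ≤ X * volume B1 ^ (1 / 2 : ℝ) := by
    have hint : ∫ y in B1, (G y - c) = -(c * (volume B1).toReal) := by
      rw [integral_sub (hGi.mono_set hB1R) (integrableOn_const hv1t), h0, setIntegral_const, smul_eq_mul,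
        Measure.real]
      ring
    have h1 : ‖∫ y in B1, (G y - c)‖ₑ = ‖c‖ₑ * volume B1 := by
      rw [hint, enorm_neg, enorm_mul, Real.enorm_eq_ofReal ENNReal.toReal_nonneg, ENNReal.ofReal_toReal hv1t]
    rw [← h1]
    calc ‖∫ y in B1, (G y - c)‖ₑ ≤ ∫⁻ y in B1, ‖G y - c‖ₑ := enorm_integral_le_lintegral_enorm _
      _ = eLpNorm (fun y => G y - c) 1 (volume.restrict B1) := by rw [eLpNorm_one_eq_lintegral_enorm]
      _ ≤ eLpNorm (fun y => G y - c) 2 (volume.restrict B1) * volume B1 ^ (1 / 2 : ℝ) :=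
          eLpNorm_one_le_sqrt_measure_mul_eLpNorm_two hGcm 1
      _ ≤ X * volume B1 ^ (1 / 2 : ℝ) := by
          gcongr
          rw [hX, hμR]
          exact eLpNorm_mono_measure _ (Measure.restrict_mono hB1R le_rfl)
  have hc : ‖c‖ₑ ≤ X * volume B1 ^ (1 / 2 : ℝ) / volume B1 :=
    (ENNReal.le_div_iff_mul_le (Or.inl hv10) (Or.inl hv1t)).2 hcB1
  -- Step 3: triangle inequality in `L²(B_R)`
  have hconst : eLpNorm (fun _ : EuclideanSpace ℝ (Fin 2) => c) 2 μR = ‖c‖ₑ * volume BR ^ (1 / 2 : ℝ) := by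
    rw [eLpNorm_const' c two_ne_zero ENNReal.ofNat_ne_top, hμR, Measure.restrict_apply_univ, ENNReal.toReal_ofNat]
  have hsplit : eLpNorm G 2 μR ≤ X + ‖c‖ₑ * volume BR ^ (1 / 2 : ℝ) := by
    have hdecomp : G = (fun y => G y - c) + fun _ => c := by funext y; simp
    calc eLpNorm G 2 μR = eLpNorm ((fun y => G y - c) + fun _ => c) 2 μR := by rw [← hdecomp]
      _ ≤ eLpNorm (fun y => G y - c) 2 μR + eLpNorm (fun _ : EuclideanSpace ℝ (Fin 2) => c) 2 μR :=
          eLpNorm_add_le hGcm.restrict aestronglyMeasurable_const (by norm_num)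
      _ = X + ‖c‖ₑ * volume BR ^ (1 / 2 : ℝ) := by rw [hX, hconst]
  calc eLpNorm G 2 μR ≤ X + ‖c‖ₑ * volume BR ^ (1 / 2 : ℝ) := hsplit
    _ ≤ X + X * volume B1 ^ (1 / 2 : ℝ) / volume B1 * volume BR ^ (1 / 2 : ℝ) := by gcongr
    _ = (1 + volume BR ^ (1 / 2 : ℝ) * volume B1 ^ (1 / 2 : ℝ) * (volume B1)⁻¹) * X := by rw [div_eq_mul_inv]; ring
    _ ≤ (1 + volume BR ^ (1 / 2 : ℝ) * volume B1 ^ (1 / 2 : ℝ) * (volume B1)⁻¹) *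
          (ENNReal.ofReal (4 * R) * eLpNorm (fderiv ℝ G) 2 volume) := by gcongr
    _ = (1 + volume BR ^ (1 / 2 : ℝ) * volume B1 ^ (1 / 2 : ℝ) * (volume B1)⁻¹) * ENNReal.ofReal (4 * R) *
          eLpNorm (fderiv ℝ G) 2 volume := by ring

/-! ## §2 The `L²` Cauchy estimate for normalised potentials -/

/-- ★ **THE `L²` CAUCHY ESTIMATE FOR NORMALISED POTENTIALS.**  Let `f, f'` be `C¹` potentials of the rotated mollified fields of `A` at two
test kernels `ρ, ρ'` (H1 `exists_potential_mollified_rot`), and normalise both to mean zero on `B₁(0)`.  Then for every `R ≥ 1`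
`‖(f − ⨍_{B₁}f) − (f' − ⨍_{B₁}f')‖_{L²(B_R)} ≤ K₂(R)·(‖ρ ⋆ A₀ − ρ' ⋆ A₀‖_{L²} + ‖ρ ⋆ A₁ − ρ' ⋆ A₁‖_{L²})`, `K₂(R)` the constant of
`eLpNorm_two_ball_le`. [cite: Evans2010, §5.8.1 Thm. 1] -/
theorem eLpNorm_two_sub_normalised_potentials_le {A : EuclideanSpace ℝ (Fin 2) → EuclideanSpace ℝ (Fin 2)}
    (hA : ∀ k : Fin 2, LocallyIntegrable (fun y => A y k) volume)
    {ρ ρ' : EuclideanSpace ℝ (Fin 2) → ℝ} (hρ : IsTestFunctionOn (⊤ : Opens (EuclideanSpace ℝ (Fin 2))) ρ)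
    (hρ' : IsTestFunctionOn (⊤ : Opens (EuclideanSpace ℝ (Fin 2))) ρ')
    {f f' : EuclideanSpace ℝ (Fin 2) → ℝ}
    (hf : ∀ a, HasFDerivAt f (innerSL ℝ
        ((-(ρ ⋆[lsmul ℝ ℝ, volume] fun y => A y 1) a) • EuclideanSpace.single (0 : Fin 2) (1:ℝ) +
          (ρ ⋆[lsmul ℝ ℝ, volume] fun y => A y 0) a • EuclideanSpace.single (1 : Fin 2) (1:ℝ))) a)
    (hf' : ∀ a, HasFDerivAt f' (innerSL ℝ
        ((-(ρ' ⋆[lsmul ℝ ℝ, volume] fun y => A y 1) a) • EuclideanSpace.single (0 : Fin 2) (1:ℝ) +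
          (ρ' ⋆[lsmul ℝ ℝ, volume] fun y => A y 0) a • EuclideanSpace.single (1 : Fin 2) (1:ℝ))) a)
    {R : ℝ} (hR : 1 ≤ R) :
    eLpNorm ((fun x => f x - ⨍ z in ball (0 : EuclideanSpace ℝ (Fin 2)) 1, f z) -
        fun x => f' x - ⨍ z in ball (0 : EuclideanSpace ℝ (Fin 2)) 1, f' z) 2
        (volume.restrict (ball (0 : EuclideanSpace ℝ (Fin 2)) R)) ≤
      (1 + volume (ball (0 : EuclideanSpace ℝ (Fin 2)) R) ^ (1 / 2 : ℝ) *
          volume (ball (0 : EuclideanSpace ℝ (Fin 2)) 1) ^ (1 / 2 : ℝ) * (volume (ball (0 : EuclideanSpace ℝ (Fin 2)) 1))⁻¹) *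
        ENNReal.ofReal (4 * R) *
        (eLpNorm ((ρ ⋆[lsmul ℝ ℝ, volume] fun y => A y 0) - (ρ' ⋆[lsmul ℝ ℝ, volume] fun y => A y 0)) 2 volume +
          eLpNorm ((ρ ⋆[lsmul ℝ ℝ, volume] fun y => A y 1) - (ρ' ⋆[lsmul ℝ ℝ, volume] fun y => A y 1)) 2 volume) := by
  -- abbreviations
  set M₀ : EuclideanSpace ℝ (Fin 2) → ℝ := ρ ⋆[lsmul ℝ ℝ, volume] fun y => A y 0 with hM₀
  set M₁ : EuclideanSpace ℝ (Fin 2) → ℝ := ρ ⋆[lsmul ℝ ℝ, volume] fun y => A y 1 with hM₁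
  set M₀' : EuclideanSpace ℝ (Fin 2) → ℝ := ρ' ⋆[lsmul ℝ ℝ, volume] fun y => A y 0 with hM₀'
  set M₁' : EuclideanSpace ℝ (Fin 2) → ℝ := ρ' ⋆[lsmul ℝ ℝ, volume] fun y => A y 1 with hM₁'
  have hM₀c : ContDiff ℝ 1 M₀ := contDiff_mollify hρ (hA 0)
  have hM₁c : ContDiff ℝ 1 M₁ := contDiff_mollify hρ (hA 1)
  have hM₀'c : ContDiff ℝ 1 M₀' := contDiff_mollify hρ' (hA 0)
  have hM₁'c : ContDiff ℝ 1 M₁' := contDiff_mollify hρ' (hA 1)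
  have hfc : ContDiff ℝ 1 f := (potential_props hM₁c.neg hM₀c hf).1
  have hf'c : ContDiff ℝ 1 f' := (potential_props hM₁'c.neg hM₀'c hf').1
  -- the difference `G` of the normalised potentials
  set c : ℝ := ⨍ z in ball (0 : EuclideanSpace ℝ (Fin 2)) 1, f z with hc
  set c' : ℝ := ⨍ z in ball (0 : EuclideanSpace ℝ (Fin 2)) 1, f' z with hc'
  set G : EuclideanSpace ℝ (Fin 2) → ℝ := (fun x => f x - c) - fun x => f' x - c' with hG
  have hGc : ContDiff ℝ 1 G := (hfc.sub contDiff_const).sub (hf'c.sub contDiff_const)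
  -- `∫_{B₁} G = 0`
  have hG0 : ∫ y in ball (0 : EuclideanSpace ℝ (Fin 2)) 1, G y = 0 := by
    have hv1t : volume (ball (0 : EuclideanSpace ℝ (Fin 2)) 1) ≠ ⊤ := measure_ball_lt_top.ne
    have hi : ∀ {g : EuclideanSpace ℝ (Fin 2) → ℝ}, Continuous g → IntegrableOn g (ball (0 : EuclideanSpace ℝ (Fin 2)) 1) volume :=
      fun hg => (hg.continuousOn.integrableOn_compact (isCompact_closedBall (0 : EuclideanSpace ℝ (Fin 2)) 1)).mono_set
        ball_subset_closedBall
    have h1 := setIntegral_unitBall_sub_average_eq_zero hfc.continuous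
    have h2 := setIntegral_unitBall_sub_average_eq_zero hf'c.continuous
    have hsplit : ∫ y in ball (0 : EuclideanSpace ℝ (Fin 2)) 1, G y =
        (∫ y in ball (0 : EuclideanSpace ℝ (Fin 2)) 1, (f y - c)) - ∫ y in ball (0 : EuclideanSpace ℝ (Fin 2)) 1, (f' y - c') := by
      have hGy : ∀ y, G y = (f y - c) - (f' y - c') := fun y => rfl
      simp_rw [hGy]
      exact integral_sub ((hi hfc.continuous).sub (integrableOn_const hv1t)) ((hi hf'c.continuous).sub (integrableOn_const hv1t))
    rw [hsplit, h1, h2, sub_zero]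
  -- the differential of `G`
  have hGd : ∀ a, HasFDerivAt G (innerSL ℝ ((-(M₁ a - M₁' a)) • EuclideanSpace.single (0 : Fin 2) (1:ℝ) +
      (M₀ a - M₀' a) • EuclideanSpace.single (1 : Fin 2) (1:ℝ))) a := by
    intro a
    have h := ((hf a).sub_const c).sub ((hf' a).sub_const c')
    have heq : innerSL ℝ ((-(M₁ a)) • EuclideanSpace.single (0 : Fin 2) (1:ℝ) + M₀ a • EuclideanSpace.single (1 : Fin 2) (1:ℝ)) -
        innerSL ℝ ((-(M₁' a)) • EuclideanSpace.single (0 : Fin 2) (1:ℝ) + M₀' a • EuclideanSpace.single (1 : Fin 2) (1:ℝ)) =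
        innerSL ℝ ((-(M₁ a - M₁' a)) • EuclideanSpace.single (0 : Fin 2) (1:ℝ) +
          (M₀ a - M₀' a) • EuclideanSpace.single (1 : Fin 2) (1:ℝ)) := by
      rw [← map_sub]
      congr 1
      ext i
      fin_cases i
      all_goals simp
      all_goals ring
    rw [heq] at h
    exact h
  have hGfd : fderiv ℝ G = fun a => innerSL ℝ ((-(M₁ a - M₁' a)) • EuclideanSpace.single (0 : Fin 2) (1:ℝ) +
      (M₀ a - M₀' a) • EuclideanSpace.single (1 : Fin 2) (1:ℝ)) := funext fun a => (hGd a).fderiv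
  -- `‖DG‖_{L²} ≤ ‖ΔM₁‖₂ + ‖ΔM₀‖₂`
  have hM₀m : AEStronglyMeasurable (M₀ - M₀') volume := (hM₀c.continuous.sub hM₀'c.continuous).aestronglyMeasurable
  have hM₁m : AEStronglyMeasurable (M₁ - M₁') volume := (hM₁c.continuous.sub hM₁'c.continuous).aestronglyMeasurable
  have hDG : eLpNorm (fderiv ℝ G) 2 volume ≤ eLpNorm (M₀ - M₀') 2 volume + eLpNorm (M₁ - M₁') 2 volume := by
    rw [hGfd]
    have h := eLpNorm_innerSL_vec2_le (W₀ := fun a => -(M₁ a - M₁' a)) (W₁ := fun a => M₀ a - M₀' a) hM₁m.neg hM₀m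
    have hneg : eLpNorm (fun a => -(M₁ a - M₁' a)) 2 volume = eLpNorm (M₁ - M₁') 2 volume := by
      rw [show (fun a => -(M₁ a - M₁' a)) = -(M₁ - M₁') from rfl, eLpNorm_neg]
    rw [hneg] at h
    calc _ ≤ eLpNorm (M₁ - M₁') 2 volume + eLpNorm (fun a => M₀ a - M₀' a) 2 volume := h
      _ = eLpNorm (M₀ - M₀') 2 volume + eLpNorm (M₁ - M₁') 2 volume := by rw [add_comm]; rfl
  -- H2
  calc eLpNorm G 2 (volume.restrict (ball (0 : EuclideanSpace ℝ (Fin 2)) R))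
      ≤ (1 + volume (ball (0 : EuclideanSpace ℝ (Fin 2)) R) ^ (1 / 2 : ℝ) *
          volume (ball (0 : EuclideanSpace ℝ (Fin 2)) 1) ^ (1 / 2 : ℝ) * (volume (ball (0 : EuclideanSpace ℝ (Fin 2)) 1))⁻¹) *
        ENNReal.ofReal (4 * R) * eLpNorm (fderiv ℝ G) 2 volume := eLpNorm_two_ball_le hGc hG0 hR
    _ ≤ _ := by gcongr

end Summit.QuantumFields.YangMills.Theorems.PoincareLipschitzPlanarStreamFunctionL2Letters

end
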